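import Mathlib.Analysis.SpecialFunctions.Pow.Real
import Mathlib.Algebra.Order.Chebyshev
import Mathlib.Algebra.BigOperators.Field
import HarnessLib

/-!
# Replica overlap moments of a spin distribution: `⟨q²⟩`, `⟨q⁴⟩` as sums of squared correlators, the
  two printed normalisations, and the Binder cumulant

Topic `Literature/Probability/Moments` (pub-qadeq lane, CLAIMS rows E-18 / E-31 / E-49 and the
spoof-1 reports S14-E18 / S17-E49: the D-Wave "beyond-classical" quench experiments and their
classical challengers are scored by the Edwards–Anderson overlap moments and the Binder cumulant;
companion of `Literature.Computability.QuantumComplexity.CorrelationError`).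

HONEST FRAMING: instance-level adjudication of specific advantage claims; no claim about BQP vs BPP
or the summit. This file TYPES the printed statistics and proves the finite identities the primaries
state for them; it says nothing about any experiment, any dynamics, or any critical exponent.

## Sources (verbatim)

[KingEtAl2023] A. D. King et al., *Quantum critical dynamics in a 5000-qubit programmable spin glass*,
Nature 617, 61 (2023) = arXiv:2207.13800 (pp. 3, 10, 28, 30 of the arXiv PDF): "Spin-glass order is
quantified via the overlap between two replicas (independently annealed `N`-spin states `S` and
`S′`) of a given realization (set of couplings `J_ij`): `q = (1/N) Σ_{i=1}^N S_i S′_i`,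
`S_i, S′_i ∈ {−1, 1}` (8). The mean-squared Edwards-Anderson order parameter is given by `⟨q²⟩`,
with `⟨·⟩` denoting an average over both independent replicas and realizations." … "The Binder
cumulant `U = ½(3 − ⟨q⁴⟩/⟨q²⟩²)` (9)"; SM eq. (S36): "`⟨q_ab²⟩ = (1/N²) Σ_{i,j} ⟨S_i^{(a)}S_j^{(a)}⟩
⟨S_i^{(b)}S_j^{(b)}⟩`, where the expectation value factors because the two replicas are
statistically independent", (S37): "`⟨q²⟩ = (1/N²) Σ_{i,j} ⟨S_iS_j⟩²`"; (S49a,b): the two Binder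
ratios `R_a = [⟨q⁴⟩/⟨q²⟩²]`, `R_b = [⟨q⁴⟩]/[⟨q²⟩]²`.

[KingEtAl2025] A. D. King, A. Nocera et al., *Beyond-classical computation in quantum simulation*,
Science 388, 199 (2025) = arXiv:2403.00910 (p. 3 eq. (3), p. 5 eq. (5)): "a spin-glass order
parameter `⟨q²⟩ = (2/(N(N−1))) Σ_{i<j} c_ij²` (3) … Here, `c_ij = ⟨σ^z_i σ^z_j⟩` is the two-point
correlation function"; "the Binder cumulant `U = ½(3 − [⟨q⁴⟩]/[⟨q²⟩]²)` (5)".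

## Contents (all proved, 0 named facts)

Configurations are `x : ι → Bool` on a finite site set `ι` (`|ι| = N`), spins `σ x i = ±1`; a
"state" is any real weight `w : (ι → Bool) → ℝ` (a probability vector in the applications; the
identities below are algebraic and need no sign or normalisation hypothesis unless stated).
* `overlap x y = (1/N) Σ_i σ_i(x) σ_i(y)` (eq. (8)/(S35)); `corr w i j = ⟨σ_iσ_j⟩_w`,
  `corr4 w i j k l = ⟨σ_iσ_jσ_kσ_l⟩_w`; `moment2 w = ⟨q²⟩`, `moment4 w = ⟨q⁴⟩` — expectations over two
  INDEPENDENT replicas drawn from `w` (double sum with weight `w x · w y`).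
* **(S36)–(S37)** `moment2_eq` (`⟨q²⟩ = (1/N²) Σ_{i,j} ⟨σ_iσ_j⟩²`) and its fourth-order analogue
  `moment4_eq` (`⟨q⁴⟩ = (1/N⁴) Σ_{i,j,k,l} ⟨σ_iσ_jσ_kσ_l⟩²`) — "the expectation value factors because
  the two replicas are statistically independent".
* **The two printed normalisations differ by the coincident-index terms**: `corr_self` (`⟨σ_iσ_i⟩ = Σ w`)
  and `moment2_eq_inv_add` — for a probability vector, `⟨q²⟩_{(S37)} = 1/N + (1/N²) Σ_{i≠j} c_ij²`,
  i.e. `= 1/N + ((N−1)/N) · q2Distinct` where `q2Distinct w = (1/(N(N−1))) Σ_{i≠j} c_ij²` is eq. (3)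
  of [KingEtAl2025] (`q2Distinct_eq_pairs`: `= (2/(N(N−1))) Σ_{i<j} c_ij²` by symmetry). An
  adjudication comparing `⟨q²⟩` or Binder values ACROSS papers must say which normalisation each uses.
* `binderCumulant m₂ m₄ = ½(3 − m₄/m₂²)` (eq. (9)/(5); SM p. 30: "U = (3 − R)/2"), `overlap_self`
  (`q(x,x) = 1`), `moment2_pos` (`⟨q²⟩ > 0` for a probability vector on `N ≥ 1` sites),
  `moment2_sq_le_moment4` (`⟨q²⟩² ≤ ⟨q⁴⟩`, Cauchy–Schwarz over the replica pair), hence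
  `binderCumulant_moments_le_one` (`U ≤ 1`), `binderCumulant_le_one` / `binderCumulant_eq_one_iff`
  (`U ≤ 1` given `m₂ ≠ 0`, `m₂² ≤ m₄`; `U = 1 ↔ m₄ = m₂²`).

Not formalised: disorder averages `[·]` (a further finite average — the `R_a`/`R_b` distinction is
recorded in the docstrings only), estimators from finitely many samples (U-statistics, bias of `R_a`),
dynamic finite-size scaling, Kibble–Zurek exponents, any dynamics.
-/

noncomputable section

open Finset

namespace Literature.Probability.Moments

namespace ReplicaOverlap

variable {ι : Type*} [Fintype ι] [DecidableEq ι]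

/-- The `±1` value of a Boolean-coded spin (`true ↦ +1`, `false ↦ −1`); the same one-line coding as
`Literature.Combinatorics.Optimization.LocalIsing`'s `spin`, restated to keep this file import-free.
[cite: KingEtAl2023, eq. (8) ("S_i, S′_i ∈ {−1, 1}")] -/
def σ (x : ι → Bool) (i : ι) : ℝ :=
  if x i then 1 else -1

omit [Fintype ι] [DecidableEq ι] in
/-- `σ_i(x)² = 1`. [cite: KingEtAl2023, eq. (8)] -/
theorem σ_mul_self (x : ι → Bool) (i : ι) : σ x i * σ x i = 1 := by
  unfold σ; split_ifs <;> norm_num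

/-- The replica overlap `q = (1/N) Σ_i S_i S′_i` of two configurations.
[cite: KingEtAl2023, eq. (8) and SM eq. (S35)] -/
def overlap (x y : ι → Bool) : ℝ :=
  (∑ i, σ x i * σ y i) / Fintype.card ι

/-- The two-point correlator `c_ij = ⟨σ_i σ_j⟩_w = Σ_x w(x) σ_i(x) σ_j(x)`.
[cite: KingEtAl2025, eq. (3) ("c_ij = ⟨σ^z_i σ^z_j⟩ is the two-point correlation function")] -/
def corr (w : (ι → Bool) → ℝ) (i j : ι) : ℝ :=
  ∑ x, w x * (σ x i * σ x j)

/-- The four-point correlator `⟨σ_i σ_j σ_k σ_l⟩_w`.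
[cite: KingEtAl2023, eq. (9) (⟨q⁴⟩ requires fourth moments)] -/
def corr4 (w : (ι → Bool) → ℝ) (i j k l : ι) : ℝ :=
  ∑ x, w x * (σ x i * σ x j * σ x k * σ x l)

/-- `⟨q²⟩`: the mean squared overlap of two INDEPENDENT replicas drawn from `w`.
[cite: KingEtAl2023, eq. (8) ("⟨·⟩ denoting an average over both independent replicas")] -/
def moment2 (w : (ι → Bool) → ℝ) : ℝ :=
  ∑ x, ∑ y, w x * w y * overlap x y ^ 2

/-- `⟨q⁴⟩`: the mean fourth power of the overlap of two independent replicas.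
[cite: KingEtAl2023, eq. (9)] -/
def moment4 (w : (ι → Bool) → ℝ) : ℝ :=
  ∑ x, ∑ y, w x * w y * overlap x y ^ 4

/-! ### (S36)–(S37): overlap moments are sums of squared correlators -/

/-- The algebra behind (S36): for any weights `w` and features `A`,
`Σ_x Σ_y w(x) w(y) (Σ_p A(x,p) A(y,p))² = Σ_p Σ_p' (Σ_x w(x) A(x,p) A(x,p'))²` — squaring the overlap of
two independent copies and averaging factorises into products of one-copy correlators.
[cite: KingEtAl2023, SM eq. (S36) ("the expectation value factors because the two replicas are
statistically independent")] -/
theorem sum_sum_mul_sq_sum {X P : Type*} [Fintype X] [Fintype P] (w : X → ℝ) (A : X → P → ℝ) :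
    ∑ x, ∑ y, w x * w y * (∑ p, A x p * A y p) ^ 2 =
      ∑ p, ∑ p', (∑ x, w x * (A x p * A x p')) ^ 2 := by
  have hL : ∀ x y, w x * w y * (∑ p, A x p * A y p) ^ 2 =
      ∑ pp : P × P, (w x * (A x pp.1 * A x pp.2)) * (w y * (A y pp.1 * A y pp.2)) := by
    intro x y
    rw [sq, Finset.sum_mul_sum, ← Fintype.sum_prod_type', Finset.mul_sum]
    exact Finset.sum_congr rfl fun pp _ => by ring
  have hR : ∀ pp : P × P, (∑ x, w x * (A x pp.1 * A x pp.2)) ^ 2 =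
      ∑ x, ∑ y, (w x * (A x pp.1 * A x pp.2)) * (w y * (A y pp.1 * A y pp.2)) := by
    intro pp
    rw [sq, Finset.sum_mul_sum]
  rw [← Fintype.sum_prod_type' (f := fun p p' => (∑ x, w x * (A x p * A x p')) ^ 2)]
  simp only [hL, hR]
  calc ∑ x, ∑ y, ∑ pp : P × P, w x * (A x pp.1 * A x pp.2) * (w y * (A y pp.1 * A y pp.2))
      = ∑ x, ∑ pp : P × P, ∑ y, w x * (A x pp.1 * A x pp.2) * (w y * (A y pp.1 * A y pp.2)) :=
        Finset.sum_congr rfl fun x _ => Finset.sum_comm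
    _ = ∑ pp : P × P, ∑ x, ∑ y, w x * (A x pp.1 * A x pp.2) * (w y * (A y pp.1 * A y pp.2)) :=
        Finset.sum_comm

/-- **(S36)/(S37)**: `⟨q²⟩ = (1/N²) Σ_{i,j} ⟨σ_iσ_j⟩²` — "the expectation value factors because the
two replicas are statistically independent". [cite: KingEtAl2023, SM eqs. (S36)–(S37)] -/
theorem moment2_eq (w : (ι → Bool) → ℝ) :
    moment2 w = (∑ i, ∑ j, corr w i j ^ 2) / (Fintype.card ι : ℝ) ^ 2 := by
  have h := sum_sum_mul_sq_sum w (fun x i => σ x i)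
  unfold moment2 overlap corr
  simp only [div_pow]
  rw [← h, Finset.sum_div]
  refine Finset.sum_congr rfl fun x _ => ?_
  rw [Finset.sum_div]
  refine Finset.sum_congr rfl fun y _ => ?_
  ring

/-- The fourth-order analogue of (S37): `⟨q⁴⟩ = (1/N⁴) Σ_{i,j,k,l} ⟨σ_iσ_jσ_kσ_l⟩²` (the same
factorisation, with `q² = Σ_{(i,j)} (σ_iσ_j)(x)·(σ_iσ_j)(y)/N²` as an overlap over index PAIRS).
[cite: KingEtAl2023, eq. (9) with SM eq. (S36) (independent replicas)] -/
theorem moment4_eq (w : (ι → Bool) → ℝ) :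
    moment4 w = (∑ i, ∑ j, ∑ k, ∑ l, corr4 w i j k l ^ 2) / (Fintype.card ι : ℝ) ^ 4 := by
  have h := sum_sum_mul_sq_sum w (fun x (ij : ι × ι) => σ x ij.1 * σ x ij.2)
  have hsq : ∀ x y : ι → Bool, (∑ i, σ x i * σ y i) ^ 4 =
      (∑ ij : ι × ι, σ x ij.1 * σ x ij.2 * (σ y ij.1 * σ y ij.2)) ^ 2 := by
    intro x y
    rw [show (4 : ℕ) = 2 * 2 by norm_num, pow_mul, sq (∑ i, σ x i * σ y i), Finset.sum_mul_sum,
      ← Fintype.sum_prod_type']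
    congr 1
    exact Finset.sum_congr rfl fun ij _ => by ring
  have hcorr : ∑ ij : ι × ι, ∑ kl : ι × ι,
      (∑ x, w x * (σ x ij.1 * σ x ij.2 * (σ x kl.1 * σ x kl.2))) ^ 2 =
      ∑ i, ∑ j, ∑ k, ∑ l, corr4 w i j k l ^ 2 := by
    simp only [Fintype.sum_prod_type, corr4]
    refine Finset.sum_congr rfl fun i _ => Finset.sum_congr rfl fun j _ =>
      Finset.sum_congr rfl fun k _ => Finset.sum_congr rfl fun l _ => ?_
    congr 1
    exact Finset.sum_congr rfl fun x _ => by ring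
  unfold moment4 overlap
  simp only [div_pow, hsq]
  rw [← hcorr, ← h, Finset.sum_div]
  refine Finset.sum_congr rfl fun x _ => ?_
  rw [Finset.sum_div]
  refine Finset.sum_congr rfl fun y _ => ?_
  ring

/-! ### The two printed normalisations of `⟨q²⟩` differ by the coincident-index terms -/

/-- `⟨σ_iσ_i⟩ = Σ_x w(x)` (`= 1` for a probability vector): the diagonal correlators are trivial.
[cite: KingEtAl2023, eq. (8) (S_i² = 1)] -/
theorem corr_self (w : (ι → Bool) → ℝ) (i : ι) : corr w i i = ∑ x, w x := by
  unfold corr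
  exact Finset.sum_congr rfl fun x _ => by rw [σ_mul_self, mul_one]

/-- The DISTINCT-pair order parameter `(1/(N(N−1))) Σ_{i≠j} c_ij²` of [KingEtAl2025] eq. (3)
(there written `(2/(N(N−1))) Σ_{i<j} c_ij²`; see `q2Distinct_eq_pairs`).
[cite: KingEtAl2025, eq. (3)] -/
def q2Distinct (w : (ι → Bool) → ℝ) : ℝ :=
  (∑ i, ∑ j ∈ Finset.univ.erase i, corr w i j ^ 2) / ((Fintype.card ι : ℝ) * (Fintype.card ι - 1))

/-- `c_ij = c_ji`. [cite: KingEtAl2025, eq. (3)] -/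
theorem corr_comm (w : (ι → Bool) → ℝ) (i j : ι) : corr w i j = corr w j i := by
  unfold corr
  exact Finset.sum_congr rfl fun x _ => by ring

/-- The ordered-pair sum is twice the unordered one: `Σ_{i≠j} c_ij² = 2 Σ_{i<j} c_ij²`, so
`q2Distinct = (2/(N(N−1))) Σ_{i<j} c_ij²` exactly as printed (any linear order on the sites).
[cite: KingEtAl2025, eq. (3)] -/
theorem q2Distinct_eq_pairs [LinearOrder ι] (w : (ι → Bool) → ℝ) :
    q2Distinct w = 2 * (∑ i, ∑ j ∈ Finset.univ.filter (fun j => i < j), corr w i j ^ 2) /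
      ((Fintype.card ι : ℝ) * (Fintype.card ι - 1)) := by
  unfold q2Distinct
  congr 1
  have hsplit : ∀ i : ι, ∑ j ∈ Finset.univ.erase i, corr w i j ^ 2 =
      ∑ j ∈ Finset.univ.filter (fun j => i < j), corr w i j ^ 2 +
        ∑ j ∈ Finset.univ.filter (fun j => j < i), corr w i j ^ 2 := by
    intro i
    rw [← Finset.sum_union]
    · congr 1
      ext j
      simp only [Finset.mem_erase, Finset.mem_univ, and_true, Finset.mem_union, Finset.mem_filter,
        true_and]
      exact ⟨fun h => (Ne.symm h).lt_or_gt, fun h => h.elim ne_of_gt ne_of_lt⟩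
    · rw [Finset.disjoint_filter]
      exact fun j _ h1 h2 => lt_asymm h1 h2
  simp only [hsplit, Finset.sum_add_distrib, two_mul]
  congr 1
  -- the second block is the first with (i, j) swapped
  have e1 : ∑ i, ∑ j ∈ Finset.univ.filter (fun j => j < i), corr w i j ^ 2 =
      ∑ i, ∑ j, if j < i then corr w i j ^ 2 else 0 :=
    Finset.sum_congr rfl fun i _ => Finset.sum_filter _ _
  have e2 : ∑ i, ∑ j ∈ Finset.univ.filter (fun j => i < j), corr w i j ^ 2 =
      ∑ i, ∑ j, if i < j then corr w i j ^ 2 else 0 :=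
    Finset.sum_congr rfl fun i _ => Finset.sum_filter _ _
  rw [e1, e2, Finset.sum_comm]
  exact Finset.sum_congr rfl fun j _ => Finset.sum_congr rfl fun i _ => by rw [corr_comm]

/-- **`⟨q²⟩_{(S37)} = 1/N + (1/N²) Σ_{i≠j} c_ij² = 1/N + ((N−1)/N) · q2Distinct`** for a probability
vector `w` on `N ≥ 2` sites: the all-index normalisation of [KingEtAl2023] (S37) and the
distinct-pair normalisation of [KingEtAl2025] eq. (3) differ by the `N` coincident-index terms
`c_ii² = 1`. [cite: KingEtAl2023, SM eq. (S37)] [cite: KingEtAl2025, eq. (3)] -/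
theorem moment2_eq_inv_add (w : (ι → Bool) → ℝ) (hw : ∑ x, w x = 1) (hN : 2 ≤ Fintype.card ι) :
    moment2 w = 1 / Fintype.card ι + (Fintype.card ι - 1) / Fintype.card ι * q2Distinct w := by
  have hN0 : (Fintype.card ι : ℝ) ≠ 0 := by
    have : (2 : ℝ) ≤ Fintype.card ι := by exact_mod_cast hN
    linarith
  have hN1 : (Fintype.card ι : ℝ) - 1 ≠ 0 := by
    have : (2 : ℝ) ≤ Fintype.card ι := by exact_mod_cast hN
    linarith
  have hdiag : ∑ i, ∑ j, corr w i j ^ 2 =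
      Fintype.card ι + ∑ i, ∑ j ∈ Finset.univ.erase i, corr w i j ^ 2 := by
    have : ∀ i : ι, ∑ j, corr w i j ^ 2 = 1 + ∑ j ∈ Finset.univ.erase i, corr w i j ^ 2 := by
      intro i
      rw [← Finset.add_sum_erase _ _ (Finset.mem_univ i), corr_self, hw, one_pow]
    simp only [this, Finset.sum_add_distrib, Finset.sum_const, Finset.card_univ, nsmul_eq_mul,
      mul_one]
  rw [moment2_eq, hdiag, q2Distinct]
  field_simp

/-! ### The Binder cumulant -/

/-- The Binder cumulant `U = ½(3 − ⟨q⁴⟩/⟨q²⟩²)` as a function of the two moments (for a disordered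
ensemble [KingEtAl2023] SM (S49b) / [KingEtAl2025] eq. (5) insert the disorder AVERAGES `[⟨q⁴⟩]`,
`[⟨q²⟩]`; (S49a) averages the ratio instead — both are this function at different arguments).
[cite: KingEtAl2023, eq. (9)] [cite: KingEtAl2025, eq. (5)] -/
def binderCumulant (m₂ m₄ : ℝ) : ℝ :=
  (3 - m₄ / m₂ ^ 2) / 2

/-- `U = 1 ↔ ⟨q⁴⟩ = ⟨q²⟩²` (`⟨q²⟩ ≠ 0`): the cumulant saturates exactly when `q²` does not
fluctuate. [cite: KingEtAl2023, eq. (9)] -/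
theorem binderCumulant_eq_one_iff {m₂ m₄ : ℝ} (h : m₂ ≠ 0) :
    binderCumulant m₂ m₄ = 1 ↔ m₄ = m₂ ^ 2 := by
  unfold binderCumulant
  have h2 : m₂ ^ 2 ≠ 0 := pow_ne_zero 2 h
  constructor
  · intro hU
    have : m₄ / m₂ ^ 2 = 1 := by linarith
    rwa [div_eq_one_iff_eq h2] at this
  · intro hm
    rw [hm, div_self h2]
    norm_num

/-- `U ≤ 1` whenever `⟨q²⟩ ≠ 0` and `⟨q²⟩² ≤ ⟨q⁴⟩` (at `⟨q²⟩ = 0` the junk value of `x/0 = 0`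
would give `3/2`). [cite: KingEtAl2023, eq. (9)] -/
theorem binderCumulant_le_one {m₂ m₄ : ℝ} (h0 : m₂ ≠ 0) (h : m₂ ^ 2 ≤ m₄) :
    binderCumulant m₂ m₄ ≤ 1 := by
  unfold binderCumulant
  have h2 : 0 < m₂ ^ 2 := by positivity
  have : 1 ≤ m₄ / m₂ ^ 2 := by rwa [le_div_iff₀ h2, one_mul]
  linarith

omit [DecidableEq ι] in
/-- `q(x, x) = 1` (`N ≥ 1`). [cite: KingEtAl2023, eq. (8)] -/
theorem overlap_self [Nonempty ι] (x : ι → Bool) : overlap x x = 1 := by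
  unfold overlap
  simp only [σ_mul_self, Finset.sum_const, Finset.card_univ, nsmul_eq_mul, mul_one]
  exact div_self (Nat.cast_ne_zero.mpr Fintype.card_ne_zero)

/-- `0 < ⟨q²⟩` for a probability vector on `N ≥ 1` sites (the coincident-replica terms already
contribute `Σ_x w(x)² > 0`). [cite: KingEtAl2023, eq. (8)] -/
theorem moment2_pos [Nonempty ι] (w : (ι → Bool) → ℝ) (hw0 : ∀ x, 0 ≤ w x) (hw : ∑ x, w x = 1) :
    0 < moment2 w := by
  obtain ⟨x₀, hx₀⟩ : ∃ x, 0 < w x := by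
    by_contra! h
    have : ∑ x, w x ≤ 0 := Finset.sum_nonpos fun x _ => h x
    linarith
  have hterm : ∀ x y : ι → Bool, 0 ≤ w x * w y * overlap x y ^ 2 := fun x y => by
    have := hw0 x
    have := hw0 y
    positivity
  unfold moment2
  calc (0 : ℝ) < w x₀ * w x₀ * overlap x₀ x₀ ^ 2 := by
        rw [overlap_self, one_pow, mul_one]
        exact mul_pos hx₀ hx₀
    _ ≤ ∑ y, w x₀ * w y * overlap x₀ y ^ 2 :=
        Finset.single_le_sum (f := fun y => w x₀ * w y * overlap x₀ y ^ 2) (fun y _ => hterm x₀ y)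
          (Finset.mem_univ x₀)
    _ ≤ ∑ x, ∑ y, w x * w y * overlap x y ^ 2 :=
        Finset.single_le_sum (f := fun x => ∑ y, w x * w y * overlap x y ^ 2)
          (fun x _ => Finset.sum_nonneg fun y _ => hterm x y) (Finset.mem_univ x₀)

/-- **`⟨q²⟩² ≤ ⟨q⁴⟩`** for a probability vector `w` (Cauchy–Schwarz / Jensen over the replica pair).
[cite: KingEtAl2023, eq. (9) (U is built from the second and fourth overlap moments)] -/
theorem moment2_sq_le_moment4 (w : (ι → Bool) → ℝ) (hw0 : ∀ x, 0 ≤ w x) (hw : ∑ x, w x = 1) :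
    moment2 w ^ 2 ≤ moment4 w := by
  -- Cauchy–Schwarz on the replica PAIR with weights `W(x,y) = w x · w y` (`Σ W = 1`):
  -- `(Σ W q²)² ≤ (Σ W) · (Σ W q⁴)`.
  have ha : ∀ xy : (ι → Bool) × (ι → Bool), 0 ≤ w xy.1 * w xy.2 := fun xy =>
    mul_nonneg (hw0 _) (hw0 _)
  have h := Finset.sum_sq_le_sum_mul_sum_of_sq_le_mul
    (Finset.univ : Finset ((ι → Bool) × (ι → Bool)))
    (r := fun xy => w xy.1 * w xy.2 * overlap xy.1 xy.2 ^ 2) (f := fun xy => w xy.1 * w xy.2)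
    (g := fun xy => w xy.1 * w xy.2 * overlap xy.1 xy.2 ^ 4) (fun xy _ => ha xy)
    (fun xy _ => mul_nonneg (ha xy) (by positivity)) (fun xy _ => le_of_eq (by ring))
  have hW : ∑ xy : (ι → Bool) × (ι → Bool), w xy.1 * w xy.2 = 1 := by
    rw [Fintype.sum_prod_type' (f := fun x y => w x * w y), ← Finset.sum_mul_sum, hw, mul_one]
  simp only [hW, one_mul] at h
  unfold moment2 moment4
  rw [← Fintype.sum_prod_type', ← Fintype.sum_prod_type']
  exact h

/-- Hence **`U ≤ 1`** for the replica-overlap moments of any probability vector.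
[cite: KingEtAl2023, eq. (9)] -/
theorem binderCumulant_moments_le_one [Nonempty ι] (w : (ι → Bool) → ℝ) (hw0 : ∀ x, 0 ≤ w x)
    (hw : ∑ x, w x = 1) : binderCumulant (moment2 w) (moment4 w) ≤ 1 :=
  binderCumulant_le_one (moment2_pos w hw0 hw).ne' (moment2_sq_le_moment4 w hw0 hw)

end ReplicaOverlap

end Literature.Probability.Moments
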